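import Mathlib
import Summits.QuantumFields.BalabanUV.T4Continuum.Support.SliceFlatSkeleton

/-!
# T⁴ programme, node NE3 (η-rate of the minimisers) — THE FLAT RUNG, part 15: `NE3Shape` AT THE FLAT DATA FROM THE CONSISTENCY
# READINGS ALONE — threshold-free (the one type's proof re-run with the flat KERNEL-FORM bounds in place of the printed bundles)

Fifteenth generation of the NE3 prover lineage P1 of the cell `pub-balaban`, file 9.  Part 14 (`SliceFlatSkeleton`, p203684) applied
the lineage's one type `SliceCovariantLevels.ne3Shape_torusCovE_upto_of_printedStatements` (p199789) at the flat data and obtained its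
conclusion `∃ M₁ a₀ > 0, (M₁ ≤ M → ∀ α₀ > 0, M·α₀ ≤ a₀ → ∃ C′, NE3Shape R C′ (L^{−a}))` — where the printed thresholds of [B9] Thm 3.1
(`M ≥ M₁`, `Mα₀ ≤ a₀`) survive as an existential quantified AFTER the block-size parameter `M`, hence opaque (a reader cannot exclude
`M₁ > M` from the statement alone, although the flat witnesses are `M₁ = a₀ = 1`).  THIS FILE removes the artefact: at `U = 1` the
three printed-statement bundles are replaced by the KERNEL-FORM bounds they came from — item 0 `SliceFlatPropagator.gFlat_rowBound`
(g13), item 1 `SliceFlatGradient.cubeSum_gFlat_colDiff_le` (g15), the (3.49) entry bound `SliceFlatGaugeDecay.flatNg_le_349` (g14), positivity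
`SliceFlatOperators.posDef_kLevE_flat` (g13) — and the one type's own proof (truncation beyond level `k`,
`SliceCovariantTower.sliceKernel_bound_torusI_of_printedType`, the hypothesis-free flat telescoping `SliceFlatOperators.sum_sliceKernel_flat`,
`ne3Shape_of_slices_rpow_card0`) is re-run:
 * `flat_rowBounds` — the (3.42) row clauses for the flat carrier `flatA ν j = ![gFlat j, (gFlat j·colDiff ν)ᵀ, 0, 0]`, all four slots, `j ≤ k`,
   level-free constants;
 * **`ne3Shape_flat`** — for every `ι`, readings carrier `R`, direction `ν`: the CONSISTENCY readings of the one type for the flat tower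
   with `D k V := colDiff ν` (`hdl` on a row of `gFlat k·colDiff ν` over the unit-face skeleton, `h1 h3 h4 h5 ht hosc hact hvol hread hresp
   hpair` verbatim) imply **`∃ C′, NE3Shape R C′ (L^{−a})`** outright.
So at `U = 1` the located gap of NE3 is, with no proviso, EXACTLY the consistency readings (wall (W2): the face-transmission structure of
`U_{k+1}(V)` one rung above B11 (9)–(10), unprinted).  At `U ≠ 1` nothing changes (wall (W1): [B9] Thms 3.1∕3.3∕(3.49)∕3.11 BY NAME).
NE3 is NOT proved.

Honest framing: finite-T⁴ ultraviolet bookkeeping about MINIMISERS (rung (B)+1 of the cell's ladder); no conditional of the cell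
(`BetaPertH`, (B), (B^μ)) is used or hidden; nothing bears on infinite volume, a mass gap, or the Clay problem.  ABSOLUTE RULE of
the cell kept: inputs are kernel-proved tree modules only; no `def … : Prop`, no `sorry`, no axioms beyond Mathlib's.  PLACEMENT
(human rule 2026-08-19): cell work under `Summits/QuantumFields/BalabanUV/`; moves nothing.  Records: `t4/T4-EST-U1b-OSC.md` v1.33,
`t4/T4-EST-NE3-P1.md` v2.32 of the cell `pub-balaban`.
-/

noncomputable section

open Real Finset Matrix

namespace Summit.QuantumFields.BalabanUV.T4Continuum.SliceFlatShape

open Literature.MathematicalPhysics.QuantumFieldTheory.Balaban1983to89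
open Literature.MathematicalPhysics.QuantumFieldTheory.Balaban1983to89.TreeLengthTorus (TPt)
open Literature.MathematicalPhysics.QuantumFieldTheory.Balaban1983to89.T4SliceTelescoping (sliceKernel sliceConst)
open Literature.MathematicalPhysics.QuantumFieldTheory.Balaban1983to89.T4EtaRateMin (Readings NE3Shape)
open Literature.MathematicalPhysics.QuantumFieldTheory.Balaban1983to89.T4FixedPointResponse (OneStepCorrectionRate)
open Literature.MathematicalPhysics.QuantumFieldTheory.Balaban1983to89.T4SliceOperatorData
open Summit.QuantumFields.BalabanUV.T4Continuum
open SliceTorusBlocks SliceTorusBlockModel SliceTorusTower SliceTorusFaces SliceCovariantModel SliceCovariantTower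
open SliceCovariantSkeleton SliceCovariantPrincipal SliceCovariantLevels SliceTorusComb SliceTorusSkeleton SliceFlatPropagator
open SliceFlatOperators SliceFlatGaugeDecay SliceFlatReadings SliceFlatFreeResolvent SliceFlatGradientPrep SliceFlatGradient

variable (d : ℕ)

/-- **The (3.42) row clauses for the flat carrier, all four slots, level-free constants** (item 0: `gFlat_rowBound`; item 1:
`cubeSum_gFlat_colDiff_le`; items 2, 3: zero carriers): `∃ B₀ δ₀ > 0 ∀ k N L, j ≤ k, ν, U, m, x, y₁:
Σ_{z : cubeI j z = y₁} |flatA ν j m U x z| ≤ B₀·pref4(L^j)_m·e^{−δ₀·nbd_j(cubeI x, y₁)}`. [folklore] -/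
theorem flat_rowBounds :
    ∃ B₀ δ₀ : ℝ, 0 < B₀ ∧ 0 < δ₀ ∧ ∀ (k N L : ℕ) [NeZero N] [NeZero L] (j : ℕ), j ≤ k → ∀ (ν : Fin (d + 1))
      {Bg : B9.Backgrounds} (U : Bg.Cfg) (m : Fin 4) (x : TPt (d + 1) (N * L ^ k) × Fin (d + 1)) (y₁ : TPt (d + 1) (levM k N L j)),
        ∑ z ∈ Finset.univ.filter (fun z => cubeI (d + 1) k N L (Fin (d + 1)) j z = y₁), |flatA d k N L ν j m U x z|
          ≤ B₀ * B9.pref4 ((L : ℝ) ^ j) m * Real.exp (-(δ₀ * nbd (d + 1) k N L j (cubeI (d + 1) k N L (Fin (d + 1)) j x) y₁)) := by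
  obtain ⟨B₁, δ, hB₁, hδ, hrow⟩ := cubeSum_rowDiff_gFlat_le d
  have hf0 := flatδ₀_pos d
  refine ⟨max (flatB₀ d) B₁, min (flatδ₀ d) δ, lt_max_of_lt_right hB₁, lt_min hf0 hδ, fun k N L _ _ j hj ν Bg U m x y₁ => ?_⟩
  have hL0 : (0 : ℝ) ≤ (L : ℝ) := Nat.cast_nonneg L
  have hLj : (0 : ℝ) ≤ (L : ℝ) ^ j := pow_nonneg hL0 _
  have hB₀ : 0 ≤ max (flatB₀ d) B₁ := le_trans (flatB₀_nonneg d) (le_max_left _ _)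
  have hnn : (0 : ℝ) ≤ (nbd (d + 1) k N L j (cubeI (d + 1) k N L (Fin (d + 1)) j x) y₁ : ℝ) := Nat.cast_nonneg _
  have hexp0 : Real.exp (-(flatδ₀ d * nbd (d + 1) k N L j (cubeI (d + 1) k N L (Fin (d + 1)) j x) y₁))
      ≤ Real.exp (-(min (flatδ₀ d) δ * nbd (d + 1) k N L j (cubeI (d + 1) k N L (Fin (d + 1)) j x) y₁)) :=
    Real.exp_le_exp.2 (neg_le_neg (mul_le_mul_of_nonneg_right (min_le_left _ _) hnn))
  have hexp1 : Real.exp (-(δ * nbd (d + 1) k N L j (cubeI (d + 1) k N L (Fin (d + 1)) j x) y₁))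
      ≤ Real.exp (-(min (flatδ₀ d) δ * nbd (d + 1) k N L j (cubeI (d + 1) k N L (Fin (d + 1)) j x) y₁)) :=
    Real.exp_le_exp.2 (neg_le_neg (mul_le_mul_of_nonneg_right (min_le_right _ _) hnn))
  fin_cases m
  · show ∑ z ∈ Finset.univ.filter (fun z => cubeI (d + 1) k N L (Fin (d + 1)) j z = y₁), |gFlat d k N L j x z|
      ≤ max (flatB₀ d) B₁ * ((L : ℝ) ^ j) ^ 2 * Real.exp (-(min (flatδ₀ d) δ * nbd (d + 1) k N L j (cubeI (d + 1) k N L (Fin (d + 1)) j x) y₁))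
    refine (gFlat_rowBound d k N L j x y₁).trans ?_
    gcongr
    · exact le_max_left _ _
  · show ∑ z ∈ Finset.univ.filter (fun z => cubeI (d + 1) k N L (Fin (d + 1)) j z = y₁), |(gFlat d k N L j * colDiff d k N L ν).transpose x z|
      ≤ max (flatB₀ d) B₁ * (L : ℝ) ^ j * Real.exp (-(min (flatδ₀ d) δ * nbd (d + 1) k N L j (cubeI (d + 1) k N L (Fin (d + 1)) j x) y₁))
    simp only [Matrix.transpose_apply]
    refine (cubeSum_gFlat_colDiff_le d k N L hrow hj ν x y₁).trans ?_
    gcongr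
    · exact le_max_right _ _
  · show ∑ z ∈ Finset.univ.filter (fun z => cubeI (d + 1) k N L (Fin (d + 1)) j z = y₁), |(0 : Matrix _ _ ℝ) x z|
      ≤ max (flatB₀ d) B₁ * (L : ℝ) ^ j * Real.exp (-(min (flatδ₀ d) δ * nbd (d + 1) k N L j (cubeI (d + 1) k N L (Fin (d + 1)) j x) y₁))
    simp only [Matrix.zero_apply, abs_zero, Finset.sum_const_zero]
    positivity
  · show ∑ z ∈ Finset.univ.filter (fun z => cubeI (d + 1) k N L (Fin (d + 1)) j z = y₁), |(0 : Matrix _ _ ℝ) x z|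
      ≤ max (flatB₀ d) B₁ * 1 * Real.exp (-(min (flatδ₀ d) δ * nbd (d + 1) k N L j (cubeI (d + 1) k N L (Fin (d + 1)) j x) y₁))
    simp only [Matrix.zero_apply, abs_zero, Finset.sum_const_zero]
    positivity

/-- **`NE3Shape` AT THE FLAT DATA FROM THE CONSISTENCY READINGS ALONE — THRESHOLD-FREE.**  For every index type `ι`, readings carrier
`R` and direction `ν`: the consistency readings of the lineage's one type for the flat tower (`E := flatE`, `Kc := cubeComb`, `Rm := flatRm`,
`am := flatAm`, `Ng := flatNg`, `G_j = gFlat j`, `D k V := colDiff ν`; `hdl` on a row of `gFlat k·colDiff ν` over the unit-face skeleton)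
imply `∃ C′, NE3Shape R C′ (L^{−a})`.  Proof = the proof of `SliceCovariantLevels.ne3Shape_torusCovE_upto_of_printedStatements` with the
printed bundles replaced by the flat kernel-form bounds (`flat_rowBounds`, `flatNg_le_349`, `posDef_kLevE_flat`) and the telescoping by the
hypothesis-free `sum_sliceKernel_flat`.  HONEST: `U = 1` only; the consistency readings (wall (W2)) are hypotheses; NE3 is NOT proved. [folklore] -/
theorem ne3Shape_flat {ι : Type} {Xr : Type*} [Fintype Xr] {R : Readings ι Xr}
    (N L : ℕ) [NeZero N] [NeZero L] (ν : Fin (d + 1))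
    {z dl sig blk lam t osc nrm pair : ℕ → ι → ℝ} {CJ CB B CPo CD B0 CR Γ Λr ρ₂ a : ℝ}
    (hL : 2 ≤ L) (ha0 : 0 < a) (ha : a < 1) (hd : 1 ≤ d)
    (hdl : ∀ k, ∀ V ∈ R.dom, ∃ x : TPt (d + 1) (N * L ^ k) × Fin (d + 1),
      dl k V ≤ ∑ y ∈ faceSkelI (d + 1) k N L (Fin (d + 1)), |(gFlat d k N L k * colDiff d k N L ν) x y|)
    (h1 : ∀ k : ℕ, ∀ V ∈ R.dom, z k V ≤ dl k V * sig k V + blk k V)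
    (h3 : ∀ k : ℕ, ∀ V ∈ R.dom, 0 ≤ sig k V ∧ sig k V ≤ CJ * lam k V)
    (h4 : ∀ k : ℕ, ∀ V ∈ R.dom, 0 ≤ blk k V ∧ blk k V ≤ CB * (1 + k * Real.log L) * lam k V)
    (h5 : ∀ k : ℕ, ∀ V ∈ R.dom, 0 ≤ lam k V ∧ lam k V ≤ B * ((L : ℝ)⁻¹ ^ k) ^ 3)
    (hCJ : 0 ≤ CJ) (hCB : 0 ≤ CB) (hCPo : 0 ≤ CPo) (hCD : 0 ≤ CD) (hB : 0 ≤ B) (hB0 : 0 ≤ B0) (hCR : 0 ≤ CR)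
    (hΓ : 0 ≤ Γ) (hΛr : 0 ≤ Λr) (hρ₂ : 0 ≤ ρ₂)
    (ht : ∀ k : ℕ, ∀ V ∈ R.dom, t k V ≤ B0 * CR * (L : ℝ)⁻¹ ^ k)
    (hosc : ∀ k : ℕ, ∀ V ∈ R.dom, osc k V ≤ (1 + CD) * (1 + CPo) * z k V / ((L : ℝ)⁻¹ ^ k) ^ 2 + t k V)
    (hact : ∀ k : ℕ, ∀ V ∈ R.dom, R.act k V = ∑ x, R.loc k V x) (hvol : (Fintype.card Xr : ℝ) ≤ R.vol)
    (hread : ∀ k : ℕ, ∀ V ∈ R.dom, ∀ x : Xr, |R.loc (k + 1) V x - R.loc k V x| ≤ Λr * nrm k V + pair k V)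
    (hresp : ∀ k : ℕ, ∀ V ∈ R.dom, nrm k V ≤ Γ * osc k V)
    (hpair : OneStepCorrectionRate R.dom pair ρ₂ ((L : ℝ) ^ (-a))) :
    ∃ C' : ℝ, NE3Shape R C' ((L : ℝ) ^ (-a)) := by
  have hd2 : 2 ≤ d + 1 := by omega
  obtain ⟨B₀, δ₀, hB₀, hδ₀, h342f⟩ := flat_rowBounds d
  obtain ⟨δ₁, C₃, hδ₁, hC₃, h349f⟩ := flatNg_le_349 d
  have hLpos : 0 < L := by omega
  have hLr : (1 : ℝ) ≤ L := by exact_mod_cast one_le_L L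
  have hLr0 : (0 : ℝ) < L := by linarith
  -- decay rate and constant of the slices (as in the one type, with `amax = 1`)
  set δ : ℝ := min δ₀ (δ₁ / 2) / 2 with hδdef
  have hmin : 0 < min δ₀ (δ₁ / 2) := lt_min hδ₀ (by linarith)
  have hδpos : 0 < δ := by rw [hδdef]; linarith
  have hδ₀' : δ < δ₀ := by
    have h1 : min δ₀ (δ₁ / 2) ≤ δ₀ := min_le_left _ _
    rw [hδdef]; linarith
  have hδ₁' : δ ≤ δ₁ / 2 := by
    have h1 : min δ₀ (δ₁ / 2) ≤ δ₁ / 2 := min_le_right _ _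
    rw [hδdef]; linarith
  set C : ℝ := printedCA B₀ δ₀ δ ((d + 1 : ℕ) : ℝ) ((2 : ℝ) ^ (d + 1)) (d + 1)
      * (1 + printedCA B₀ δ₀ δ ((d + 1 : ℕ) : ℝ) ((2 : ℝ) ^ (d + 1)) (d + 1)
        * printedCP 1 C₃ δ₁ δ L ((d + 1 : ℕ) : ℝ) (d + 1)) with hCdef
  have hC : 0 ≤ C := by
    have h1 : 0 ≤ printedCA B₀ δ₀ δ ((d + 1 : ℕ) : ℝ) ((2 : ℝ) ^ (d + 1)) (d + 1) := printedCA_nonneg hB₀.le (by positivity) hδ₀'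
    have h2 : 0 ≤ printedCP 1 C₃ δ₁ δ (L : ℝ) ((d + 1 : ℕ) : ℝ) (d + 1) := printedCP_nonneg zero_le_one hC₃.le hLr
    rw [hCdef]; positivity
  -- (3.42) and (3.49) for the flat carriers at levels `j ≤ k`, kernel form, NO thresholds
  have h342 : ∀ k j, j ≤ k → B9.Ineq342_346_347
      (matrixFamily (cubeI (d + 1) k N L (Fin (d + 1)) j) (fun y y₁ => (nbd (d + 1) k N L j y y₁ : ℝ)) j (L : ℝ) 0
        (flatA d k N L ν j (B := unitBg))) B₀ δ₀ PUnit.unit := by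
    intro k j hj
    refine ineq342_matrixFamily_of_rowBounds _ _ j 0 (flatA d k N L ν j (B := unitBg)) PUnit.unit hB₀.le hLr0.le
      fun m x y₁ => ?_
    exact h342f k N L j hj ν (Bg := unitBg) PUnit.unit m x y₁
  have h349 : ∀ k j, j ≤ k → B9.Ineq349 (d + 1)
      (fineKernelOf (cubeI (d + 1) k N L (Fin (d + 1)) j) (fun y y₁ => (nbd (d + 1) k N L j y y₁ : ℝ)) j (L : ℝ) 0
        (flatFk d k N L j (B := unitBg))) C₃ δ₁ PUnit.unit := by
    intro k j hj
    refine ineq349_fineKernelOf_of_entryBounds _ _ j 0 (flatFk d k N L j (B := unitBg)) PUnit.unit hC₃.le hLr0 fun m z w => ?_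
    have hLj : (0 : ℝ) < (L : ℝ) ^ j := pow_pos hLr0 _
    by_cases hm : m = 3
    · subst hm
      simpa only [flatFk, if_true, cubeI_apply] using h349f k N L j hj z w
    · simp only [flatFk, if_neg hm, Matrix.zero_apply, abs_zero]
      have hpi : 0 ≤ B9.pref4inv ((L : ℝ) ^ j) m := by fin_cases m <;> simp [B9.pref4inv]
      exact mul_nonneg (mul_nonneg (mul_nonneg hC₃.le hpi) (Real.rpow_nonneg hLj.le _)) (Real.exp_nonneg _)
  -- the slice bounds `hg` via the family TRUNCATED beyond level `k`
  have hg : ∀ k, ∀ V ∈ R.dom, ∀ i < k + 1, ∀ x y : TPt (d + 1) (N * L ^ k) × Fin (d + 1),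
      |sliceKernel (gLevE (flatE d k N L) (cubeComb (d + 1) k N L) (flatRm d k N L) (wB L (d + 1)) (aB L (d + 1) flatAm) (flatNg d k N L))
          (kPart (cubeComb (d + 1) k N L) (flatRm d k N L) (wB L (d + 1)) (aB L (d + 1) flatAm) (flatNg d k N L)) (colDiff d k N L ν) i x y|
        ≤ C * (Real.exp (-(δ * ((nplI (d + 1) k N L (Fin (d + 1)) x y : ℝ) / (L : ℝ) ^ i))) / ((L : ℝ) ^ i) ^ (d + 1 - 1)) := by
    intro k V _ i hi x y
    let Ng0 : ℕ → Matrix (TPt (d + 1) (N * L ^ k) × Fin (d + 1)) (TPt (d + 1) (N * L ^ k) × Fin (d + 1)) ℝ :=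
      fun j => if j ≤ k then flatNg d k N L j else 0
    let G0 : ℕ → Matrix (TPt (d + 1) (N * L ^ k) × Fin (d + 1)) (TPt (d + 1) (N * L ^ k) × Fin (d + 1)) ℝ :=
      fun j => if j ≤ k then (gLevE (flatE d k N L) (cubeComb (d + 1) k N L) (flatRm d k N L) (wB L (d + 1)) (aB L (d + 1) flatAm) (flatNg d k N L)) j else 0
    let A0 : ∀ j, Fin 4 → (unitBg).Cfg → Matrix (TPt (d + 1) (N * L ^ k) × Fin (d + 1)) (TPt (d + 1) (N * L ^ k) × Fin (d + 1)) ℝ :=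
      fun j m u => if j ≤ k then flatA d k N L ν j (B := unitBg) m u else 0
    let F0 : ∀ j, Fin 4 → (unitBg).Cfg → Matrix (TPt (d + 1) (N * L ^ k) × Fin (d + 1)) (TPt (d + 1) (N * L ^ k) × Fin (d + 1)) ℝ :=
      fun j m u => if j ≤ k then flatFk d k N L j (B := unitBg) m u else 0
    have hK0 := kPart_eq_massKernel (cubeComb (d + 1) k N L) (flatRm d k N L) flatAm Ng0 (cubeComb_blk (d + 1) k N L)
    have hbound := sliceKernel_bound_torusI_of_printedType (d + 1) k N L (Fin (d + 1)) 0
      (fun j y y₁ => (nbd (d + 1) k N L j y y₁ : ℝ)) (fun _ => unitBg) (fun _ => PUnit.unit) A0 F0 G0 Ng0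
      (kPart (cubeComb (d + 1) k N L) (flatRm d k N L) (wB L (d + 1)) (aB L (d + 1) flatAm) Ng0) (colDiff d k N L ν)
      (fun j => tau (cubeComb (d + 1) k N L j) (flatRm d k N L)) flatAm
      (by omega) hB₀.le hC₃.le hδpos.le hδ₀' hδ₁' zero_le_one (fun j y y₁ => le_rfl) (fun j => ?_) (fun j => ?_) (fun j => ?_)
      (fun j => ?_) (fun j => ?_) (fun j z w => abs_tau_le_one (cubeComb (d + 1) k N L j) (flatRm d k N L) (flatRm_isometric d k N L) z w)
      (fun j => ⟨zero_le_one, le_rfl⟩) hK0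
    · have hcongr := sliceKernel_congr_upto G0 (gLevE (flatE d k N L) (cubeComb (d + 1) k N L) (flatRm d k N L) (wB L (d + 1)) (aB L (d + 1) flatAm) (flatNg d k N L))
        (kPart (cubeComb (d + 1) k N L) (flatRm d k N L) (wB L (d + 1)) (aB L (d + 1) flatAm) Ng0) (kPart (cubeComb (d + 1) k N L) (flatRm d k N L) (wB L (d + 1)) (aB L (d + 1) flatAm) (flatNg d k N L)) (colDiff d k N L ν) k
        (fun j hj => by simp [G0, hj]) (fun j hj => kPart_congr (by simp [Ng0, hj])) i (by omega)
      rw [← hcongr, cast_nplI]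
      exact hbound i x y
    · show A0 j 0 PUnit.unit = G0 j
      by_cases hj : j ≤ k
      · simp only [A0, G0, if_pos hj]; exact flatA_zero d k N L ν j (B := unitBg) PUnit.unit
      · simp only [A0, G0, if_neg hj]
    · show A0 j 1 PUnit.unit = (G0 j * colDiff d k N L ν).transpose
      by_cases hj : j ≤ k
      · simp only [A0, G0, if_pos hj]; exact flatA_one d k N L ν j (B := unitBg) PUnit.unit
      · simp only [A0, G0, if_neg hj, Matrix.zero_mul, Matrix.transpose_zero]
    · show F0 j 3 PUnit.unit = Ng0 j
      by_cases hj : j ≤ k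
      · simp only [F0, Ng0, if_pos hj]; exact flatFk_three d k N L j (B := unitBg) PUnit.unit
      · simp only [F0, Ng0, if_neg hj]
    · by_cases hj : j ≤ k
      · have hA : A0 j = flatA d k N L ν j (B := unitBg) := by funext m u; simp [A0, hj]
        rw [hA]; exact h342 k j hj
      · have hA : A0 j = fun _ _ => 0 := by funext m u; simp [A0, hj]
        rw [hA]; exact ineq342_matrixFamily_zero (Bg := unitBg) _ _ j 0 PUnit.unit hB₀.le hLr0.le
    · by_cases hj : j ≤ k
      · have hF : F0 j = flatFk d k N L j (B := unitBg) := by funext m u; simp [F0, hj]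
        rw [hF]; exact h349 k j hj
      · have hF : F0 j = fun _ _ => 0 := by funext m u; simp [F0, hj]
        rw [hF]; exact ineq349_fineKernelOf_zero (Bg := unitBg) _ _ j 0 PUnit.unit hC₃.le hLr0
  -- the located reading, TELESCOPED hypothesis-free at the flat data
  have hdl' : ∀ k, ∀ V ∈ R.dom, ∃ x : TPt (d + 1) (N * L ^ k) × Fin (d + 1),
      dl k V ≤ ∑ y ∈ faceSkelI (d + 1) k N L (Fin (d + 1)), |∑ i ∈ Finset.range (k + 1),
        sliceKernel (gLevE (flatE d k N L) (cubeComb (d + 1) k N L) (flatRm d k N L) (wB L (d + 1)) (aB L (d + 1) flatAm) (flatNg d k N L))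
          (kPart (cubeComb (d + 1) k N L) (flatRm d k N L) (wB L (d + 1)) (aB L (d + 1) flatAm) (flatNg d k N L)) (colDiff d k N L ν) i x y| := by
    intro k V hV
    obtain ⟨x, hx⟩ := hdl k V hV
    refine ⟨x, hx.trans (le_of_eq (Finset.sum_congr rfl fun y _ => ?_))⟩
    rw [sum_sliceKernel_flat]
  exact ⟨_, ne3Shape_of_slices_rpow_card0 (fun k => faceSkelI (d + 1) k N L (Fin (d + 1))) (fun k => nplI (d + 1) k N L (Fin (d + 1)))
    (fun k _ i => sliceKernel (gLevE (flatE d k N L) (cubeComb (d + 1) k N L) (flatRm d k N L) (wB L (d + 1)) (aB L (d + 1) flatAm) (flatNg d k N L))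
      (kPart (cubeComb (d + 1) k N L) (flatRm d k N L) (wB L (d + 1)) (aB L (d + 1) flatAm) (flatNg d k N L)) (colDiff d k N L ν) i)
    (fun k => (d + 1) * (N * L ^ k)) (by exact_mod_cast hL) ha0 ha hδpos hC
    (mul_nonneg (Nat.cast_nonneg _) faceConst_nonneg : (0 : ℝ) ≤ Fintype.card (Fin (d + 1)) * faceConst (d + 1) N)
    (Nat.cast_nonneg _) (faces_hℓ (d + 1) N hd2) hd2
    (fun k x => card_faceSkelI_zero_le x) (fun k x y _ => nplI_le x y) (faces_hN (d + 1) N L)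
    (fun k x r hr => card_faceSkelI_shell_le hd2 x r hr) hg hdl' h1 h3 h4 h5 hCJ hCB hCPo hCD hB hB0 hCR hΓ
    hΛr hρ₂ ht hosc hact hvol hread hresp hpair⟩

end Summit.QuantumFields.BalabanUV.T4Continuum.SliceFlatShape
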